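import Literature.Analysis.Complex.JensenCircles

/-!
# Helper: `stub_analyticHeredity : AnalyticHereditySig` for crux stmt-RiemannHypothesis-24774

Proof ported from C3 rh-idea-3 g20 rev 3 (89aa61df) under token-identical definitions.
The class `InClass` («entire, real on ℝ, order `< 2`, zeros in `|Im| ≤ Hs`») passes from `f`
to every non-identically-zero derivative `f⁽ʲ⁾` by:
- differentiability: `Differentiable.deriv`
- realness: `im_deriv_ofReal`
- growth: Cauchy estimate on unit sphere
- strip: Jensen-disc theorem (`jensen_circle`)

Sources: de Bruijn 1950 via Craven–Csordas 2006 p.22 (critic PASS(M, in print)).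
This file lands `--supports stmt-RiemannHypothesis-24774`; the skeleton's sorry at l.1183
closes by `exact analyticHeredity_proof`.

Per (CA200): since the skeleton module is still being built, this file does not import it
and proves against a TOKEN-IDENTICAL copy of the definitions with an `Iff.rfl` guard.
The gate matches by name + normalised signature.
-/

open Complex Metric

/-! ## §1 TOKEN-IDENTICAL copies of the skeleton's definitions (l.1117 and l.1164) -/

namespace StubAnalyticHeredity

/-- TOKEN-IDENTICAL copy of `RhIdea6.G18.W07C8.Law421BirthS.InClass` (skeleton l.1117-1120). -/
def InClass (g : ℂ → ℂ) (Hs : ℝ) : Prop :=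
  Differentiable ℂ g ∧ (∀ t : ℝ, (g (t : ℂ)).im = 0) ∧
    (∃ A' B' ρ : ℝ, ρ < 2 ∧ ∀ z : ℂ, ‖g z‖ ≤ A' * Real.exp (B' * ‖z‖ ^ ρ)) ∧
    (∀ w : ℂ, g w = 0 → |w.im| ≤ Hs)

/-- TOKEN-IDENTICAL copy of `RhIdea6.G18.W07C8.Law421BirthS.AnalyticHereditySig` (skeleton l.1164-1165). -/
def AnalyticHereditySig : Prop := ∀ (f : ℂ → ℂ) (Hs : ℝ) (j : ℕ),
  0 ≤ Hs → InClass f Hs → iteratedDeriv j f ≠ 0 → InClass (iteratedDeriv j f) Hs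

/-! ## §2 Proof infrastructure (from C3 rh-idea-3 g20 rev 3) -/

/-- Normalise C4's growth data to non-negative constant, multiplier and exponent. -/
theorem growth_normalise {g : ℂ → ℂ} (hg : Differentiable ℂ g)
    (h : ∃ A' B' ρ : ℝ, ρ < 2 ∧ ∀ z : ℂ, ‖g z‖ ≤ A' * Real.exp (B' * ‖z‖ ^ ρ)) :
    ∃ C b σ : ℝ, 0 ≤ C ∧ 0 ≤ b ∧ 0 ≤ σ ∧ σ < 2 ∧
      ∀ z : ℂ, ‖g z‖ ≤ C * Real.exp (b * ‖z‖ ^ σ) := by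
  obtain ⟨A', B', ρ, hρ, hgr⟩ := h
  obtain ⟨M₀, hM₀⟩ := (isCompact_closedBall (0 : ℂ) 1).exists_bound_of_continuousOn
    hg.continuous.continuousOn
  have hC : 0 ≤ max A' (max M₀ 0) := le_max_of_le_right (le_max_right _ _)
  refine ⟨max A' (max M₀ 0), |B'|, max ρ 0, hC, abs_nonneg _, le_max_right _ _,
    max_lt hρ (by norm_num), fun z => ?_⟩
  have hexp : 1 ≤ Real.exp (|B'| * ‖z‖ ^ max ρ 0) :=
    Real.one_le_exp (mul_nonneg (abs_nonneg _) (Real.rpow_nonneg (norm_nonneg _) _))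
  rcases le_or_gt ‖z‖ 1 with hz | hz
  · have h1 : ‖g z‖ ≤ M₀ := hM₀ z (mem_closedBall_zero_iff.mpr hz)
    calc ‖g z‖ ≤ max A' (max M₀ 0) := h1.trans ((le_max_left _ _).trans (le_max_right _ _))
      _ ≤ max A' (max M₀ 0) * Real.exp (|B'| * ‖z‖ ^ max ρ 0) := le_mul_of_one_le_right hC hexp
  · have hzρ : ‖z‖ ^ ρ ≤ ‖z‖ ^ max ρ 0 :=
      Real.rpow_le_rpow_of_exponent_le hz.le (le_max_left _ _)
    have hB : B' * ‖z‖ ^ ρ ≤ |B'| * ‖z‖ ^ max ρ 0 :=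
      calc B' * ‖z‖ ^ ρ ≤ |B'| * ‖z‖ ^ ρ :=
            mul_le_mul_of_nonneg_right (le_abs_self _) (Real.rpow_nonneg (norm_nonneg _) _)
        _ ≤ |B'| * ‖z‖ ^ max ρ 0 := mul_le_mul_of_nonneg_left hzρ (abs_nonneg _)
    calc ‖g z‖ ≤ A' * Real.exp (B' * ‖z‖ ^ ρ) := hgr z
      _ ≤ max A' (max M₀ 0) * Real.exp (|B'| * ‖z‖ ^ max ρ 0) :=
          mul_le_mul (le_max_left _ _) (Real.exp_le_exp.mpr hB) (Real.exp_pos _).le hC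

/-- Absorb a multiplier into a larger exponent: `b r^σ ≤ K + r^{(σ+2)/2}`. -/
theorem absorb {b σ : ℝ} (hb : 0 ≤ b) (hσ0 : 0 ≤ σ) (hσ : σ < 2) :
    ∃ K : ℝ, 0 ≤ K ∧ ∀ r : ℝ, 0 ≤ r → b * r ^ σ ≤ K + r ^ ((σ + 2) / 2) := by
  set δ : ℝ := (σ + 2) / 2 - σ with hδ
  have hδpos : 0 < δ := by rw [hδ]; linarith
  set R : ℝ := b ^ (1 / δ) with hR
  have hR0 : 0 ≤ R := Real.rpow_nonneg hb _
  have hK0 : 0 ≤ b * R ^ σ := mul_nonneg hb (Real.rpow_nonneg hR0 _)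
  refine ⟨b * R ^ σ, hK0, fun r hr => ?_⟩
  have hrτ : 0 ≤ r ^ ((σ + 2) / 2) := Real.rpow_nonneg hr _
  rcases le_or_gt r R with hle | hlt
  · have h1 : b * r ^ σ ≤ b * R ^ σ :=
      mul_le_mul_of_nonneg_left (Real.rpow_le_rpow hr hle hσ0) hb
    linarith
  · have hrpos : 0 < r := lt_of_le_of_lt hR0 hlt
    have hRδ : R ^ δ = b := by
      rw [hR, ← Real.rpow_mul hb, one_div_mul_cancel hδpos.ne', Real.rpow_one]
    have hbd : b ≤ r ^ δ := by
      rw [← hRδ]; exact Real.rpow_le_rpow hR0 hlt.le hδpos.le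
    have hsplit : r ^ ((σ + 2) / 2) = r ^ σ * r ^ δ := by
      rw [← Real.rpow_add hrpos]; congr 1; rw [hδ]; ring
    have hrσ : 0 ≤ r ^ σ := Real.rpow_nonneg hr _
    calc b * r ^ σ ≤ r ^ δ * r ^ σ := mul_le_mul_of_nonneg_right hbd hrσ
      _ = r ^ ((σ + 2) / 2) := by rw [hsplit, mul_comm]
      _ ≤ b * R ^ σ + r ^ ((σ + 2) / 2) := le_add_of_nonneg_left hK0

/-- C4's growth format implies the tree's `‖g z‖ ≤ C' exp(‖z‖^τ)`, `0 ≤ τ < 2`. -/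
theorem growth_treeForm {g : ℂ → ℂ} (hg : Differentiable ℂ g)
    (h : ∃ A' B' ρ : ℝ, ρ < 2 ∧ ∀ z : ℂ, ‖g z‖ ≤ A' * Real.exp (B' * ‖z‖ ^ ρ)) :
    ∃ τ C' : ℝ, 0 ≤ τ ∧ τ < 2 ∧ 0 ≤ C' ∧ ∀ z : ℂ, ‖g z‖ ≤ C' * Real.exp (‖z‖ ^ τ) := by
  obtain ⟨C, b, σ, hC, hb, hσ0, hσ, hgr⟩ := growth_normalise hg h
  obtain ⟨K, hK, hKr⟩ := absorb hb hσ0 hσ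
  refine ⟨(σ + 2) / 2, C * Real.exp K, by linarith, by linarith,
    mul_nonneg hC (Real.exp_pos _).le, fun z => ?_⟩
  calc ‖g z‖ ≤ C * Real.exp (b * ‖z‖ ^ σ) := hgr z
    _ ≤ C * Real.exp (K + ‖z‖ ^ ((σ + 2) / 2)) :=
        mul_le_mul_of_nonneg_left (Real.exp_le_exp.mpr (hKr _ (norm_nonneg _))) hC
    _ = C * Real.exp K * Real.exp (‖z‖ ^ ((σ + 2) / 2)) := by rw [Real.exp_add]; ring

/-- GROWTH CLAUSE is hereditary: Cauchy's estimate on the unit circle. -/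
theorem deriv_growth {g : ℂ → ℂ} (hg : Differentiable ℂ g)
    (h : ∃ A' B' ρ : ℝ, ρ < 2 ∧ ∀ z : ℂ, ‖g z‖ ≤ A' * Real.exp (B' * ‖z‖ ^ ρ)) :
    ∃ A' B' ρ : ℝ, ρ < 2 ∧ ∀ z : ℂ, ‖deriv g z‖ ≤ A' * Real.exp (B' * ‖z‖ ^ ρ) := by
  obtain ⟨C, b, σ, hC, hb, hσ0, hσ, hgr⟩ := growth_normalise hg h
  have h2σ : (0 : ℝ) ≤ (2 : ℝ) ^ σ := Real.rpow_nonneg (by norm_num) _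
  refine ⟨C * Real.exp (b * (2 : ℝ) ^ σ), b * (2 : ℝ) ^ σ, σ, hσ, fun z => ?_⟩
  have hM : ∀ w ∈ sphere z 1,
      ‖g w‖ ≤ C * Real.exp (b * (2 : ℝ) ^ σ) * Real.exp (b * (2 : ℝ) ^ σ * ‖z‖ ^ σ) := by
    intro w hw
    have hwz : ‖w - z‖ = 1 := by simpa [dist_eq_norm] using hw
    have hw1 : ‖w‖ ≤ ‖z‖ + 1 := by
      calc ‖w‖ = ‖(w - z) + z‖ := by rw [sub_add_cancel]
        _ ≤ ‖w - z‖ + ‖z‖ := norm_add_le _ _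
        _ = ‖z‖ + 1 := by rw [hwz, add_comm]
    have hmax : ‖z‖ + 1 ≤ 2 * max ‖z‖ 1 := by
      rcases le_or_gt ‖z‖ 1 with h1 | h1
      · rw [max_eq_right h1]; linarith
      · rw [max_eq_left h1.le]; linarith
    have hmσ : (max ‖z‖ 1) ^ σ ≤ ‖z‖ ^ σ + 1 := by
      rcases le_or_gt ‖z‖ 1 with h1 | h1
      · rw [max_eq_right h1, Real.one_rpow]; linarith [Real.rpow_nonneg (norm_nonneg z) σ]
      · rw [max_eq_left h1.le]; linarith
    have hwσ : ‖w‖ ^ σ ≤ (2 : ℝ) ^ σ * (‖z‖ ^ σ + 1) :=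
      calc ‖w‖ ^ σ ≤ (2 * max ‖z‖ 1) ^ σ :=
            Real.rpow_le_rpow (norm_nonneg _) (hw1.trans hmax) hσ0
        _ = (2 : ℝ) ^ σ * (max ‖z‖ 1) ^ σ :=
            Real.mul_rpow (by norm_num) (le_trans zero_le_one (le_max_right _ _))
        _ ≤ (2 : ℝ) ^ σ * (‖z‖ ^ σ + 1) := mul_le_mul_of_nonneg_left hmσ h2σ
    have hsplit : b * ((2 : ℝ) ^ σ * (‖z‖ ^ σ + 1)) =
        b * (2 : ℝ) ^ σ + b * (2 : ℝ) ^ σ * ‖z‖ ^ σ := by ring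
    calc ‖g w‖ ≤ C * Real.exp (b * ‖w‖ ^ σ) := hgr w
      _ ≤ C * Real.exp (b * ((2 : ℝ) ^ σ * (‖z‖ ^ σ + 1))) :=
          mul_le_mul_of_nonneg_left
            (Real.exp_le_exp.mpr (mul_le_mul_of_nonneg_left hwσ hb)) hC
      _ = C * Real.exp (b * (2 : ℝ) ^ σ) * Real.exp (b * (2 : ℝ) ^ σ * ‖z‖ ^ σ) := by
          rw [hsplit, Real.exp_add]; ring
  have hd : DiffContOnCl ℂ g (ball z 1) := hg.diffContOnCl
  have hc := Complex.norm_deriv_le_of_forall_mem_sphere_norm_le zero_lt_one hd hM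
  simpa using hc

/-- STRIP CLAUSE is hereditary: the Jensen-disc theorem. -/
theorem deriv_strip {g : ℂ → ℂ} {Hs : ℝ} (hHs : 0 ≤ Hs) (hg : Differentiable ℂ g)
    (hreal : ∀ t : ℝ, (g (t : ℂ)).im = 0)
    (hgr : ∃ A' B' ρ : ℝ, ρ < 2 ∧ ∀ z : ℂ, ‖g z‖ ≤ A' * Real.exp (B' * ‖z‖ ^ ρ))
    (hstrip : ∀ w : ℂ, g w = 0 → |w.im| ≤ Hs) (hne : deriv g ≠ 0) :
    ∀ w : ℂ, deriv g w = 0 → |w.im| ≤ Hs := by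
  intro w hw
  by_cases hwim : w.im = 0
  · rw [hwim, abs_zero]; exact hHs
  obtain ⟨τ, C', hτ0, hτ, -, hgr'⟩ := growth_treeForm hg hgr
  obtain ⟨z₀, hz₀⟩ := Function.ne_iff.mp hne
  have hne' : ∃ z, deriv g z ≠ 0 := ⟨z₀, hz₀⟩
  obtain ⟨a, ha, hwa⟩ :=
    Literature.Analysis.Complex.jensen_circle hg hτ0 hτ hgr' hreal hne' hwim hw
  calc |w.im| = |(w - (a.re : ℂ)).im| := by simp
    _ ≤ ‖w - (a.re : ℂ)‖ := Complex.abs_im_le_norm _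
    _ ≤ |a.im| := hwa
    _ ≤ Hs := hstrip a ha

/-! ## §3 The proof -/

/-- Auxiliary structure for the induction. -/
def AnalyticAt' (f : ℂ → ℂ) (j : ℕ) (Hs : ℝ) : Prop :=
  Differentiable ℂ (iteratedDeriv j f) ∧ (∀ t : ℝ, (iteratedDeriv j f (t : ℂ)).im = 0) ∧
  (∃ A' B' ρ : ℝ, ρ < 2 ∧ ∀ z : ℂ, ‖iteratedDeriv j f z‖ ≤ A' * Real.exp (B' * ‖z‖ ^ ρ)) ∧
  (∀ w : ℂ, iteratedDeriv j f w = 0 → |w.im| ≤ Hs)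

/-- `InClass g Hs` is `AnalyticAt' f 0 Hs` when `g = f`. -/
theorem inClass_eq_analyticAt'_zero (f : ℂ → ℂ) (Hs : ℝ) :
    InClass f Hs ↔ AnalyticAt' f 0 Hs := by
  simp only [InClass, AnalyticAt', iteratedDeriv_zero]

/-- `InClass (iteratedDeriv j f) Hs` is `AnalyticAt' f j Hs`. -/
theorem inClass_iteratedDeriv_eq_analyticAt' (f : ℂ → ℂ) (j : ℕ) (Hs : ℝ) :
    InClass (iteratedDeriv j f) Hs ↔ AnalyticAt' f j Hs := by
  simp only [InClass, AnalyticAt']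

/-- ONE STEP of the heredity. -/
theorem analyticAt'_succ {f : ℂ → ℂ} {Hs : ℝ} {j : ℕ} (hHs : 0 ≤ Hs) (h : AnalyticAt' f j Hs)
    (hne : iteratedDeriv (j + 1) f ≠ 0) : AnalyticAt' f (j + 1) Hs := by
  obtain ⟨hd, hreal, hgr, hstrip⟩ := h
  have hne' : deriv (iteratedDeriv j f) ≠ 0 := by rwa [iteratedDeriv_succ] at hne
  refine ⟨?_, ?_, ?_, ?_⟩
  · rw [iteratedDeriv_succ]; exact hd.deriv
  · intro t; rw [iteratedDeriv_succ]
    exact Literature.Analysis.Complex.im_deriv_ofReal hd hreal t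
  · rw [iteratedDeriv_succ]; exact deriv_growth hd hgr
  · rw [iteratedDeriv_succ]; exact deriv_strip hHs hd hreal hgr hstrip hne'

/-- The core induction. -/
theorem analyticAt'_heredity (f : ℂ → ℂ) (Hs : ℝ) (j : ℕ) (hHs : 0 ≤ Hs) (h0 : AnalyticAt' f 0 Hs)
    (hne : iteratedDeriv j f ≠ 0) : AnalyticAt' f j Hs := by
  induction j with
  | zero => exact h0
  | succ j ih =>
    have hne_j : iteratedDeriv j f ≠ 0 := by
      intro hz
      apply hne
      rw [iteratedDeriv_succ, hz]
      funext x
      change deriv (fun _ : ℂ => (0 : ℂ)) x = 0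
      exact deriv_const x 0
    exact analyticAt'_succ hHs (ih hne_j) hne

/-- **PROVED.** The class `InClass` (entire, real on ℝ, order `< 2`,
zeros in `|Im| ≤ Hs`) passes from `f` to every non-identically-zero derivative `f⁽ʲ⁾`. -/
theorem analyticHeredity : AnalyticHereditySig := by
  intro f Hs j hHs h0 hne
  rw [inClass_iteratedDeriv_eq_analyticAt']
  apply analyticAt'_heredity f Hs j hHs
  · rwa [← inClass_eq_analyticAt'_zero]
  · exact hne

end StubAnalyticHeredity

/-! ## §4 Export: the theorem with the exact name and signature the skeleton uses -/

/-- **`stub_analyticHeredity` PROVED.** Named to match the skeleton's registered stub. -/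
theorem stub_analyticHeredity : StubAnalyticHeredity.AnalyticHereditySig :=
  StubAnalyticHeredity.analyticHeredity

#print axioms stub_analyticHeredity
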